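import Mathlib

/-!
# The update-form three-term Grassmann–Plücker (octahedron) identity

For a matrix `M` with rows `Fin k` over a commutative ring, a column tuple `e : Fin k → ι`,
positions `a ≠ b` and column indices `u, v`, writing `M_f := M.submatrix id f`:

`det M_e · det M_{e[a↦u][b↦v]} = det M_{e[a↦u]} · det M_{e[b↦v]} − det M_{e[a↦v]} · det M_{e[b↦u]}`.

The proof goes through the quadratic Plücker relation
`det X · det Y = ∑ t, det (X.updateCol a (Y·t)) · det (Y.updateCol t (X·a))`,
which is Cramer's rule (`Matrix.mulVec_cramer`) read through the linear functional
`w ↦ det (X.updateCol a w) = Matrix.cramer X w a`.  Applied to `X := M_{e[a↦u]}`,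
`Y := M_{e[b↦v]}`, every summand with `t ∉ {a, b}` has a repeated column, and the two
surviving summands are the two displayed products.  No injectivity of `e` is needed: this is a
polynomial identity over any commutative ring.
-/

set_option linter.dupNamespace false

namespace Summit.MatrixMultiplication.MatrixMultiplication.Theorems.CondensationSound

open scoped BigOperators Matrix

/-- **Quadratic Plücker relation** (Cramer's rule read through the linear functional
`w ↦ det (X.updateCol a w)`): for square matrices `X Y` and a pivot column `a`,
`det X · det Y = ∑ t, det (X with column a := column t of Y) · det (Y with column t := column a of X)`.
[folklore] -/
theorem det_mul_det_eq_sum_det_updateCol {R : Type*} [CommRing R] {n : Type*} [Fintype n]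
    [DecidableEq n] (X Y : Matrix n n R) (a : n) :
    X.det * Y.det =
      ∑ t, (X.updateCol a (fun i => Y i t)).det * (Y.updateCol t (fun i => X i a)).det := by
  have hmul : Y *ᵥ Matrix.cramer Y (fun i => X i a) =
      ∑ t, Matrix.cramer Y (fun i => X i a) t • (fun i => Y i t) := by
    funext i
    simp only [Matrix.mulVec, dotProduct, Finset.sum_apply, Pi.smul_apply, smul_eq_mul]
    exact Finset.sum_congr rfl fun _ _ => mul_comm _ _
  have key := congrArg (Matrix.cramer X) hmul
  simp only [Matrix.mulVec_cramer, map_smul, map_sum] at key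
  have key' := congrFun key a
  simp only [Finset.sum_apply, Pi.smul_apply, smul_eq_mul, Matrix.cramer_apply,
    Matrix.updateCol_eq_self] at key'
  calc X.det * Y.det = Y.det * X.det := mul_comm _ _
    _ = _ := key'
    _ = _ := Finset.sum_congr rfl fun _ _ => mul_comm _ _

/-- **Column replacement inside a column selection.**  Replacing column `c` of the column-selected
matrix `M.submatrix id f` by column `t` of another column selection `M.submatrix id g` of the same
matrix is the column selection along the updated tuple `Function.update f c (g t)`. [folklore] -/
theorem submatrix_updateCol_eq_submatrix_update {R : Type*} {m ι : Type*} [DecidableEq m]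
    (M : Matrix m ι R) (f g : m → ι) (c t : m) :
    (M.submatrix id f).updateCol c (fun i => M.submatrix id g i t) =
      M.submatrix id (Function.update f c (g t)) := by
  ext i j
  simp only [Matrix.updateCol_apply, Matrix.submatrix_apply, id_eq, Function.update_apply]
  split_ifs <;> rfl

/-- **The update-form three-term (octahedron) Grassmann–Plücker identity.**  For a matrix `M`
with rows `Fin k` over a commutative ring, a column tuple `e : Fin k → ι`, positions `a ≠ b` and
column indices `u, v`, with `M_f := M.submatrix id f`:
`det M_e · det M_{e[a↦u][b↦v]} = det M_{e[a↦u]} · det M_{e[b↦v]} − det M_{e[a↦v]} · det M_{e[b↦u]}`.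
Proof: the quadratic Plücker relation `det_mul_det_eq_sum_det_updateCol` for
`X := M_{e[a↦u]}`, `Y := M_{e[b↦v]}` with pivot `a`; the summands `t ∉ {a, b}` vanish by a
repeated column (`Matrix.det_zero_of_column_eq`), and `Fintype.sum_eq_add a b` leaves the two
displayed products. [folklore] -/
theorem stub_threeTerm :
    ∀ (R : Type) [CommRing R] (k : ℕ) (ι : Type) (M : Matrix (Fin k) ι R) (e : Fin k → ι) (a b : Fin k)
      (u v : ι), a ≠ b →
      (M.submatrix id e).det * (M.submatrix id (Function.update (Function.update e a u) b v)).det =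
        (M.submatrix id (Function.update e a u)).det * (M.submatrix id (Function.update e b v)).det -
          (M.submatrix id (Function.update e a v)).det * (M.submatrix id (Function.update e b u)).det := by
  intro R _ k ι M e a b u v hab
  have key : (M.submatrix id (Function.update e a u)).det *
      (M.submatrix id (Function.update e b v)).det =
      ∑ t, (M.submatrix id (Function.update e a (Function.update e b v t))).det *
        (M.submatrix id (Function.update (Function.update e b v) t u)).det := by
    rw [det_mul_det_eq_sum_det_updateCol _ _ a]
    refine Finset.sum_congr rfl fun t _ => ?_
    rw [submatrix_updateCol_eq_submatrix_update, submatrix_updateCol_eq_submatrix_update,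
      Function.update_idem, Function.update_self]
  rw [Fintype.sum_eq_add a b hab] at key
  · rw [Function.update_of_ne hab, Function.update_eq_self, Function.update_comm hab.symm,
      Function.update_self, Function.update_idem] at key
    exact eq_sub_of_add_eq key.symm
  · intro t ht
    have hcol : (M.submatrix id (Function.update e a (Function.update e b v t))).det = 0 := by
      rw [Function.update_of_ne ht.2]
      refine Matrix.det_zero_of_column_eq ht.1 fun r => ?_
      simp [Function.update_of_ne ht.1]
    rw [hcol, zero_mul]

end Summit.MatrixMultiplication.MatrixMultiplication.Theorems.CondensationSound
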